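import Mathlib
import Literature.Analysis.ODE.CodeListMeanValueExtension
import Summits.Ventures.FusionMHD.Models.CerfonFreidbergNstxLikeAxis
import Summits.Ventures.FusionMHD.Models.CerfonFreidbergIterLikeMidplane
import HarnessLib

/-!
# Ventures/FusionMHD — Models/CerfonFreidbergNstxLikeMidplane.lean: the NSTX-like Cerfon–Freidberg companion has a UNIQUE midplane
# critical point (its magnetic axis) although its flux is NOT convex along the chord — inboard CONCAVITY of the computed-shape flux
# (kernel; interval range certificates; twin-with-a-difference of `CerfonFreidbergIterLikeMidplane`)

HONEST FRAMING (LADDER-GRIDFUSION three columns; rung F1.a(a) on the CF rung, qualitative companion of «F1.CF-AXIS-NSTX»).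
For the ITER-like instance `U_XX(X,0) > 0` on the whole chord (p515982).  For the NSTX-like companion (ε = 39/50: chord `11/50 ≤ X ≤ 89/50`)
this FAILS: the natural interval extension certifies `U_XX(X, 0) ≤ −1/10 < 0` on the INBOARD third `[11/50, 3/5]` (`dRR_inboard_neg`) — the
computed-shape flux is concave in `X` there — while `U_XX ≥ 1/4` on `[9/10, 89/50]`.  Uniqueness of the midplane critical point is recovered
from two kinds of range certificates (tree `CodeListMeanValueExtension.evalBoxLE`, Moore 1966 Thm 3.1; all `decide +kernel`, seconds):
`U_X(X, 0) ≤ −1/10 < 0` on `[11/50, 21/20]` (three pieces) and `U_XX(X, 0) ≥ 1/4 > 0` on `[9/10, 89/50]` (two pieces) over «(p511071's kernel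
coefficient box) × piece», whence (`midplane_criticalPoint_unique`) **`X_a ∈ [1.268203823, 1.268203826]` is the ONLY zero of `U_X(·, 0)` on
`[11/50, 89/50]`**, `U_X < 0` on `[11/50, X_a)` and `> 0` on `(X_a, 89/50]`.
CERTIFIED (kernel): as stated.  MODELLED: analytic CF family; a statement about the model flux on one chord; no stability claim.
Typer/prover: gridfusion-model-5 (g5), 2026-08-27.  Citations: Freidberg 2014 §6.6.1 [Freidberg2014]; Moore 1966 Thm 3.1 / Moore 1979 §4.3 [Moore1979].
-/

noncomputable section

open Set NonemptyInterval Matrix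
open Literature.Analysis.ODE Literature.Analysis.ODE.FExpr
open Literature.Analysis.ValidatedNumerics Literature.Analysis.ValidatedNumerics.ITaylor
open Literature.MathematicalPhysics.MHD Literature.MathematicalPhysics.MHD.GradShafranov
  Literature.MathematicalPhysics.MHD.CerfonFreidberg _root_.Real

namespace Summit.Ventures.FusionMHD.Models.CFNstxLike

/-! ## §1 Code lists, pieces, and the range certificates -/

/-- The code list of the midplane radial slope `U_X(X, 0)` of `U = cfSolution 0 c` (α = 0): `x₀…x₆ = c`, `x₇ = X` (Horner in `X²`, one log). -/
def uxExpr : FExpr 8 :=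
  add (mul (var 7) (add (add (smul 2 (var 1)) (smul (-1) (var 2))) (mul (pow (var 7) 2) (add (add (add (const (1 / 2)) (smul 4 (var 3))) (smul 3 (var 4))) (mul (pow (var 7) 2) (add (smul 6 (var 5)) (smul (-15) (var 6)))))))) (mul (log (var 7)) (mul (var 7) (add (smul (-2) (var 2)) (mul (pow (var 7) 2) (add (smul 12 (var 4)) (mul (pow (var 7) 2) (smul (-90) (var 6))))))))

/-- The `U_X` pieces `[11/50, 1/2]`, `[1/2, 4/5]`, `[4/5, 21/20]` (where `U_X < 0` is certified). -/
def slopePiece : Fin 3 → Iv :=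
  ![⟨((11 / 50), (1 / 2)), by decide +kernel⟩, ⟨((1 / 2), (4 / 5)), by decide +kernel⟩, ⟨((4 / 5), (21 / 20)), by decide +kernel⟩]

/-- The `U_XX` pieces `[9/10, 13/10]`, `[13/10, 89/50]` (where `U_XX > 0` is certified) and the inboard piece `[11/50, 3/5]` (`U_XX < 0`). -/
def curvPiece : Fin 3 → Iv :=
  ![⟨((9 / 10), (13 / 10)), by decide +kernel⟩, ⟨((13 / 10), (89 / 50)), by decide +kernel⟩, ⟨((11 / 50), (3 / 5)), by decide +kernel⟩]

/-- «p511071's coefficient box × an `X`-interval». -/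
def nBox (I : Iv) : Fin 8 → Iv :=
  fun i => if h : (i : ℕ) < 7 then axKrawczyk.box ⟨i, by omega⟩ else I

/-- Endpoints of the pieces (decided). -/
theorem pieces_eq : ((slopePiece 0).fst = 11 / 50 ∧ (slopePiece 0).snd = 1 / 2) ∧ ((slopePiece 1).fst = 1 / 2 ∧ (slopePiece 1).snd = 4 / 5)
    ∧ ((slopePiece 2).fst = 4 / 5 ∧ (slopePiece 2).snd = 21 / 20) ∧ ((curvPiece 0).fst = 9 / 10 ∧ (curvPiece 0).snd = 13 / 10)
    ∧ ((curvPiece 1).fst = 13 / 10 ∧ (curvPiece 1).snd = 89 / 50) ∧ ((curvPiece 2).fst = 11 / 50 ∧ (curvPiece 2).snd = 3 / 5) := by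
  decide +kernel

/-- **SLOPE CERTIFICATES:** `U_X(X,0) ∈ [−1, −1/10]` on each slope piece (natural extension, seeds ⟨64, 60, 56, 4, 0⟩). -/
theorem ux_range_cert : ∀ j : Fin 3, evalBoxLE ⟨64, 60, 56, 4, 0⟩ uxExpr (nBox (slopePiece j)) ⟨((-1), (-1 / 10)), by decide +kernel⟩ = true := by
  decide +kernel

/-- **CURVATURE CERTIFICATES:** `U_XX(X,0) ∈ [1/4, 4]` on the two outboard pieces … -/
theorem uxx_range_cert : ∀ j : Fin 2, evalBoxLE ⟨64, 60, 56, 4, 0⟩ CFIterLike.uxxExpr (nBox (curvPiece (j.castLE (by norm_num))))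
    ⟨((1 / 4), 4), by decide +kernel⟩ = true := by
  decide +kernel

/-- … and `U_XX(X,0) ∈ [−1, −1/10]` on the inboard piece `[11/50, 3/5]` (the flux is CONCAVE in `X` there). -/
theorem uxx_inboard_cert : evalBoxLE ⟨64, 60, 56, 4, 0⟩ CFIterLike.uxxExpr (nBox (curvPiece 2)) ⟨((-1), (-1 / 10)), by decide +kernel⟩ = true := by
  decide +kernel

/-! ## §2 Bridge and membership -/

/-- `⟦uxExpr⟧(y) = U_X(y₇, 0)` for `U = cfSolution 0 (midCoeffs y)` (`y₇ ≠ 0`). -/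
theorem eval_uxExpr (y : Fin 8 → ℝ) (hX : y 7 ≠ 0) : uxExpr.eval y = dR (cfSolution 0 (CFIterLike.midCoeffs y)) (y 7) 0 := by
  rw [dR_cfSolution_zero _ hX]
  simp [uxExpr, FExpr.eval, CFIterLike.midCoeffs, radP₂, radP₄, radP₆, radQ₂, radQ₄, radQ₆]
  ring

/-- The point `(coeff, X)` (coordinates 0–6 = `axZero`'s of the NSTX certificate). -/
def nPoint (X : ℝ) : Fin 8 → ℝ :=
  fun i => if h : (i : ℕ) < 7 then axZero ⟨i, by omega⟩ else X

/-- Its coefficient part is `coeff`. -/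
theorem midCoeffs_nPoint (X : ℝ) : CFIterLike.midCoeffs (nPoint X) = coeff := by
  funext k
  fin_cases k <;> simp [CFIterLike.midCoeffs, nPoint, coeff, axCoeffs, coeffs, axProj]

/-- Its last coordinate is `X`. -/
theorem nPoint_seven (X : ℝ) : nPoint X 7 = X := by
  simp [nPoint]

/-- For `X ∈ I`, `(coeff, X) ∈ nBox I`. -/
theorem nPoint_mem {I : Iv} {X : ℝ} (hlo : (I.fst : ℝ) ≤ X) (hhi : X ≤ (I.snd : ℝ)) : nPoint X ∈ boxSet (castBox (nBox I)) := by
  have hz := mem_boxSet_iff.mp axZero_mem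
  rw [mem_boxSet_iff]
  intro i
  rw [castBox_apply, mem_ratCast_iff]
  by_cases hi : (i : ℕ) < 7
  · have h := hz ⟨i, by omega⟩
    rw [castBox_apply, mem_ratCast_iff] at h
    simp only [nBox, nPoint, hi, dif_pos]
    exact h
  · simp only [nBox, nPoint, hi, dif_neg, not_false_eq_true]
    exact ⟨hlo, hhi⟩

/-- Reading a range certificate of `uxExpr` at `(coeff, X)`. -/
theorem dR_mem_of_cert {I J : Iv} (hc : evalBoxLE ⟨64, 60, 56, 4, 0⟩ uxExpr (nBox I) J = true) {X : ℝ} (hX : X ≠ 0)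
    (hlo : (I.fst : ℝ) ≤ X) (hhi : X ≤ (I.snd : ℝ)) : (J.fst : ℝ) ≤ dR CFNstxLike.U X 0 ∧ dR CFNstxLike.U X 0 ≤ (J.snd : ℝ) := by
  have h := eval_mem_of_evalBoxLE hc (nPoint_mem hlo hhi)
  rw [mem_ratCast_iff] at h
  have h7 : nPoint X 7 ≠ 0 := by rw [nPoint_seven]; exact hX
  rw [eval_uxExpr _ h7, midCoeffs_nPoint, nPoint_seven] at h
  exact h

/-- Reading a range certificate of `uxxExpr` at `(coeff, X)`. -/
theorem dRR_mem_of_cert {I J : Iv} (hc : evalBoxLE ⟨64, 60, 56, 4, 0⟩ CFIterLike.uxxExpr (nBox I) J = true) {X : ℝ} (hX : X ≠ 0)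
    (hlo : (I.fst : ℝ) ≤ X) (hhi : X ≤ (I.snd : ℝ)) : (J.fst : ℝ) ≤ dRR CFNstxLike.U X 0 ∧ dRR CFNstxLike.U X 0 ≤ (J.snd : ℝ) := by
  have h := eval_mem_of_evalBoxLE hc (nPoint_mem hlo hhi)
  rw [mem_ratCast_iff] at h
  have h7 : nPoint X 7 ≠ 0 := by rw [nPoint_seven]; exact hX
  rw [CFIterLike.eval_uxxExpr _ h7, midCoeffs_nPoint, nPoint_seven] at h
  exact h

/-! ## §3 Signs on the chord, inboard concavity, uniqueness of the axis -/

/-- **`U_X(X, 0) ≤ −1/10 < 0` on `[11/50, 21/20]`** (inboard two thirds of the chord). -/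
theorem dR_neg_inboard {X : ℝ} (h1 : (11 : ℝ) / 50 ≤ X) (h2 : X ≤ 21 / 20) : dR CFNstxLike.U X 0 ≤ -1 / 10 := by
  have hX : X ≠ 0 := by intro h; rw [h] at h1; norm_num at h1
  obtain ⟨⟨a1, a2⟩, ⟨b1, b2⟩, ⟨c1, c2⟩, -, -, -⟩ := pieces_eq
  have fin : ∀ j : Fin 3, ((slopePiece j).fst : ℝ) ≤ X → X ≤ ((slopePiece j).snd : ℝ) → dR CFNstxLike.U X 0 ≤ -1 / 10 := by
    intro j hlo hhi
    have h := (dR_mem_of_cert (ux_range_cert j) hX hlo hhi).2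
    have : (((-1 : ℚ) / 10 : ℚ) : ℝ) = -1 / 10 := by push_cast; ring
    linarith
  by_cases ha : X ≤ 1 / 2
  · exact fin 0 (by rw [a1]; push_cast; linarith) (by rw [a2]; push_cast; linarith)
  by_cases hb : X ≤ 4 / 5
  · exact fin 1 (by rw [b1]; push_cast; linarith) (by rw [b2]; push_cast; linarith)
  · exact fin 2 (by rw [c1]; push_cast; linarith) (by rw [c2]; push_cast; linarith)

/-- **`U_XX(X, 0) ≥ 1/4 > 0` on `[9/10, 89/50]`** (outboard part of the chord, containing the axis). -/
theorem dRR_pos_outboard {X : ℝ} (h1 : (9 : ℝ) / 10 ≤ X) (h2 : X ≤ 89 / 50) : 1 / 4 ≤ dRR CFNstxLike.U X 0 := by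
  have hX : X ≠ 0 := by intro h; rw [h] at h1; norm_num at h1
  obtain ⟨-, -, -, ⟨d1, d2⟩, ⟨e1, e2⟩, -⟩ := pieces_eq
  have c0 := uxx_range_cert 0
  have c1 := uxx_range_cert 1
  have e0 : ((0 : Fin 2).castLE (show 2 ≤ 3 by norm_num) : Fin 3) = 0 := rfl
  have e1' : ((1 : Fin 2).castLE (show 2 ≤ 3 by norm_num) : Fin 3) = 1 := rfl
  rw [e0] at c0
  rw [e1'] at c1
  have q : (((1 : ℚ) / 4 : ℚ) : ℝ) = 1 / 4 := by push_cast; ring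
  by_cases ha : X ≤ 13 / 10
  · have h := (dRR_mem_of_cert c0 hX (by rw [d1]; push_cast; linarith) (by rw [d2]; push_cast; linarith)).1
    linarith
  · have h := (dRR_mem_of_cert c1 hX (by rw [e1]; push_cast; linarith) (by rw [e2]; push_cast; linarith)).1
    linarith

/-- **INBOARD CONCAVITY:** `U_XX(X, 0) ≤ −1/10 < 0` on `[11/50, 3/5]` — the NSTX-like computed-shape flux is NOT convex along the chord
(contrast: the ITER-like instance has `U_XX ≥ 1/20` on its whole chord, `CFIterLike.dRR_midplane_pos`). -/
theorem dRR_inboard_neg {X : ℝ} (h1 : (11 : ℝ) / 50 ≤ X) (h2 : X ≤ 3 / 5) : dRR CFNstxLike.U X 0 ≤ -1 / 10 := by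
  have hX : X ≠ 0 := by intro h; rw [h] at h1; norm_num at h1
  obtain ⟨-, -, -, -, -, ⟨f1, f2⟩⟩ := pieces_eq
  have h := (dRR_mem_of_cert uxx_inboard_cert hX (by rw [f1]; push_cast; linarith) (by rw [f2]; push_cast; linarith)).2
  have : (((-1 : ℚ) / 10 : ℚ) : ℝ) = -1 / 10 := by push_cast; ring
  linarith

/-- On the outboard part `X ↦ U_X(X, 0)` is differentiable with positive derivative. -/
theorem hasDerivAt_dR_outboard {X : ℝ} (h1 : (9 : ℝ) / 10 ≤ X) (h2 : X ≤ 89 / 50) :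
    HasDerivAt (fun r => dR CFNstxLike.U r 0) (dRR CFNstxLike.U X 0) X := by
  have hpos := dRR_pos_outboard h1 h2
  rw [CFIterLike.dRR_eq_deriv_dR] at hpos ⊢
  have hd : DifferentiableAt ℝ (fun r => dR CFNstxLike.U r 0) X := differentiableAt_of_deriv_ne_zero (by linarith)
  exact hd.hasDerivAt

/-- `X ↦ U_X(X, 0)` is strictly increasing on `[9/10, 89/50]`. -/
theorem strictMonoOn_dR_outboard : StrictMonoOn (fun r => dR CFNstxLike.U r 0) (Icc (9 / 10) (89 / 50)) := by
  apply strictMonoOn_of_deriv_pos (convex_Icc _ _)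
  · intro x hx
    exact (hasDerivAt_dR_outboard hx.1 hx.2).continuousAt.continuousWithinAt
  · intro x hx
    rw [interior_Icc] at hx
    rw [← CFIterLike.dRR_eq_deriv_dR]
    linarith [dRR_pos_outboard hx.1.le hx.2.le]

/-- `X_a` lies in the outboard part. -/
theorem Xa_mem_outboard : CFNstxLike.Xa ∈ Icc (9 / 10 : ℝ) (89 / 50) := by
  constructor <;> linarith [Xa_bounds.1, Xa_bounds.2]

/-- **UNIQUENESS OF THE MIDPLANE AXIS (NSTX-like):** the only zero of `U_X(·, 0)` on the chord `[11/50, 89/50]` is `X_a`. -/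
theorem midplane_criticalPoint_unique {X : ℝ} (hX : X ∈ Icc (11 / 50 : ℝ) (89 / 50)) (h0 : dR CFNstxLike.U X 0 = 0) :
    X = CFNstxLike.Xa := by
  have ha : dR CFNstxLike.U CFNstxLike.Xa 0 = 0 := axis.1
  by_cases hin : X ≤ 21 / 20
  · have := dR_neg_inboard hX.1 hin
    linarith
  · push Not at hin
    have hXo : X ∈ Icc (9 / 10 : ℝ) (89 / 50) := ⟨by linarith, hX.2⟩
    by_contra hne
    rcases lt_or_gt_of_ne hne with hlt | hgt
    · have := strictMonoOn_dR_outboard hXo Xa_mem_outboard hlt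
      simp only at this; linarith
    · have := strictMonoOn_dR_outboard Xa_mem_outboard hXo hgt
      simp only at this; linarith

/-- `U_X(X, 0) < 0` on the chord to the left of the axis … -/
theorem dR_neg_of_lt_Xa {X : ℝ} (hX : X ∈ Icc (11 / 50 : ℝ) (89 / 50)) (hlt : X < CFNstxLike.Xa) : dR CFNstxLike.U X 0 < 0 := by
  by_cases hin : X ≤ 21 / 20
  · linarith [dR_neg_inboard hX.1 hin]
  · push Not at hin
    have hXo : X ∈ Icc (9 / 10 : ℝ) (89 / 50) := ⟨by linarith, hX.2⟩
    have := strictMonoOn_dR_outboard hXo Xa_mem_outboard hlt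
    have ha : dR CFNstxLike.U CFNstxLike.Xa 0 = 0 := axis.1
    simp only at this; linarith

/-- … and `> 0` to its right. -/
theorem dR_pos_of_Xa_lt {X : ℝ} (hX : X ∈ Icc (11 / 50 : ℝ) (89 / 50)) (hgt : CFNstxLike.Xa < X) : 0 < dR CFNstxLike.U X 0 := by
  have hXo : X ∈ Icc (9 / 10 : ℝ) (89 / 50) := ⟨by linarith [Xa_bounds.1], hX.2⟩
  have := strictMonoOn_dR_outboard Xa_mem_outboard hXo hgt
  have ha : dR CFNstxLike.U CFNstxLike.Xa 0 = 0 := axis.1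
  simp only at this; linarith

/-- The midplane critical-point set of the NSTX-like chord is the singleton `{X_a}`. -/
theorem midplane_criticalSet_eq : {X ∈ Icc (11 / 50 : ℝ) (89 / 50) | dR CFNstxLike.U X 0 = 0} = {CFNstxLike.Xa} := by
  ext X
  simp only [mem_setOf_eq, mem_singleton_iff]
  constructor
  · rintro ⟨hX, h0⟩; exact midplane_criticalPoint_unique hX h0
  · rintro rfl; exact ⟨⟨by linarith [Xa_bounds.1], by linarith [Xa_bounds.2]⟩, axis.1⟩

/-! ## §4 The midplane flux profile: decreasing to the axis, increasing after it, negative inside, strict global minimum at the axis -/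

/-- The midplane slice `X ↦ U(X, 0)` is differentiable at every `X ≠ 0` with derivative `U_X(X, 0)`. -/
theorem hasDerivAt_U_midplane {X : ℝ} (hX : X ≠ 0) : HasDerivAt (fun r => CFNstxLike.U r 0) (dR CFNstxLike.U X 0) X := by
  have hd : DifferentiableAt ℝ (fun r => CFNstxLike.U r 0) X := by
    show DifferentiableAt ℝ (fun r => cfSolution 0 coeff r 0) X
    rw [cfSolution_zero_radial coeff 0]
    have hl : DifferentiableAt ℝ Real.log X := Real.differentiableAt_log hX
    fun_prop
  exact hd.hasDerivAt

/-- `U(·, 0)` is continuous on the chord `[11/50, 89/50]`. -/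
theorem continuousOn_U_midplane : ContinuousOn (fun r => CFNstxLike.U r 0) (Icc (11 / 50 : ℝ) (89 / 50)) := by
  intro x hx
  have hx0 : x ≠ 0 := by intro h; rw [h] at hx; norm_num at hx
  exact (hasDerivAt_U_midplane hx0).continuousAt.continuousWithinAt

/-- `X_a` lies in the chord. -/
theorem Xa_mem_chord : CFNstxLike.Xa ∈ Icc (11 / 50 : ℝ) (89 / 50) :=
  ⟨by linarith [Xa_bounds.1], by linarith [Xa_bounds.2]⟩

/-- **`U(·, 0)` is strictly DECREASING on `[11/50, X_a]`** (although NOT convex there). -/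
theorem strictAntiOn_U_left : StrictAntiOn (fun r => CFNstxLike.U r 0) (Icc (11 / 50 : ℝ) CFNstxLike.Xa) := by
  apply strictAntiOn_of_deriv_neg (convex_Icc _ _)
  · exact continuousOn_U_midplane.mono (Icc_subset_Icc_right Xa_mem_chord.2)
  · intro x hx
    rw [interior_Icc] at hx
    have hx0 : x ≠ 0 := by intro h; rw [h] at hx; norm_num at hx
    rw [(hasDerivAt_U_midplane hx0).deriv]
    exact dR_neg_of_lt_Xa ⟨hx.1.le, by linarith [hx.2, Xa_mem_chord.2]⟩ hx.2

/-- **… and strictly INCREASING on `[X_a, 89/50]`.** -/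
theorem strictMonoOn_U_right : StrictMonoOn (fun r => CFNstxLike.U r 0) (Icc CFNstxLike.Xa (89 / 50 : ℝ)) := by
  apply strictMonoOn_of_deriv_pos (convex_Icc _ _)
  · exact continuousOn_U_midplane.mono (Icc_subset_Icc_left Xa_mem_chord.1)
  · intro x hx
    rw [interior_Icc] at hx
    have hx0 : x ≠ 0 := by intro h; rw [h] at hx; linarith [hx.1, Xa_pos]
    rw [(hasDerivAt_U_midplane hx0).deriv]
    exact dR_pos_of_Xa_lt ⟨by linarith [hx.1, Xa_mem_chord.1], hx.2.le⟩ hx.1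

/-- **The axis value is the STRICT GLOBAL MINIMUM of the midplane flux.** -/
theorem U_axis_lt_of_ne {X : ℝ} (hX : X ∈ Icc (11 / 50 : ℝ) (89 / 50)) (hne : X ≠ CFNstxLike.Xa) :
    CFNstxLike.U CFNstxLike.Xa 0 < CFNstxLike.U X 0 := by
  rcases lt_or_gt_of_ne hne with hlt | hgt
  · have := strictAntiOn_U_left ⟨hX.1, hlt.le⟩ ⟨Xa_mem_chord.1, le_rfl⟩ hlt
    simpa using this
  · have := strictMonoOn_U_right ⟨le_rfl, Xa_mem_chord.2⟩ ⟨hgt.le, hX.2⟩ hgt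
    simpa using this

/-- The flux vanishes at the two chord ends `(1 ± ε, 0) = (89/50, 0), (11/50, 0)`. -/
theorem U_chord_ends : CFNstxLike.U (11 / 50) 0 = 0 ∧ CFNstxLike.U (89 / 50) 0 = 0 :=
  ⟨(zero_at_constraint_points isInstance_U).2.1, (zero_at_constraint_points isInstance_U).1⟩

/-- **`U(X, 0) < 0` strictly inside the chord `11/50 < X < 89/50`.** -/
theorem U_midplane_neg {X : ℝ} (h1 : (11 : ℝ) / 50 < X) (h2 : X < 89 / 50) : CFNstxLike.U X 0 < 0 := by
  rcases le_or_gt X CFNstxLike.Xa with hle | hgt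
  · have := strictAntiOn_U_left ⟨le_rfl, Xa_mem_chord.1⟩ ⟨h1.le, hle⟩ h1
    simp only at this
    linarith [U_chord_ends.1]
  · have := strictMonoOn_U_right ⟨hgt.le, h2.le⟩ ⟨Xa_mem_chord.2, le_rfl⟩ h2
    simp only at this
    linarith [U_chord_ends.2]

/-- Midplane points are critical points of `U` iff `U_X = 0` (up–down symmetry: `U_Y(X, 0) = 0`). -/
theorem isCriticalPoint_midplane_iff (X : ℝ) : IsCriticalPoint CFNstxLike.U X 0 ↔ dR CFNstxLike.U X 0 = 0 := by
  unfold IsCriticalPoint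
  have hz : dZ CFNstxLike.U X 0 = 0 := dZ_cfSolution_zero_midplane coeff X
  exact ⟨fun h => h.1, fun h => ⟨h, hz⟩⟩

/-- **THE magnetic axis of the NSTX-like chord:** midplane critical points of the flux on `[11/50, 89/50]` ⟺ `X = X_a`. -/
theorem midplane_isCriticalPoint_iff {X : ℝ} (hX : X ∈ Icc (11 / 50 : ℝ) (89 / 50)) :
    IsCriticalPoint CFNstxLike.U X 0 ↔ X = CFNstxLike.Xa := by
  rw [isCriticalPoint_midplane_iff]
  exact ⟨midplane_criticalPoint_unique hX, fun h => h ▸ axis.1⟩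

end Summit.Ventures.FusionMHD.Models.CFNstxLike
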